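import Summits.MatrixMultiplication.OmegaCensus.SmallFormats.InvertiblePointNearColumnCore
import HarnessLib

/-!
# ω-census family (a): the MULTI-COLUMN CLAUSE AT A NEAR POINT — `p` columns cost `p` kernel dimensions, one term short of a frame

Cell `pub-omega` (unit `pub-omega-tensor`, gen 36), topic `Summits/MatrixMultiplication/OmegaCensus` (sub-folder
`SmallFormats`). Framing (verbatim): lottery ticket; floor = certified bounds/negative ranges. HONEST FRAMING: an elementary
structural lemma over an arbitrary field; the near-point analogue of tensor g34's `DeltaLaw.multi_column_clause` (saturated
points). It is the one genuinely new ingredient of the NEAR REFINED δ-LAW `dim K₀ + n ≤ dim(span{W_t : t ∉ O} ⊔ span{D(E_i)})`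
(file `InvertiblePointNearDeltaLaw`), which sharpens tensor g35's near-point law by one dimension and excludes near points at
`⟨2,2,6⟩@20`.

**Theorem (`near_multi_column_clause`).** Let `β` compute `X ↦ XY` (`X ∈ k^{2×2}`, `Y ∈ k^{2×n}`) and let `X₀ = 1` be a NEAR
point: exactly `2n + 1` terms `O` have `f_s(1) ≠ 0`. Let `K₀` be killed by every `g_t`, `t ∉ O`, let `ρ_0, …, ρ_{p-1} ∈ kⁿ` be
independent, `E ⊇ k² ⊗ span ρ` with `dim E ≤ 2p`, and let `x_0, …, x_p ∈ k²` be pairwise independent. Then `dim(K₀ ⊓ E) ≤ p`.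

Proof (`near_columns_core`, file `InvertiblePointNearColumnCore`). As in the saturated case one finds `Y_i = x_i ⊗ w_i ∈ K₀` with a relation `Σ a_i w_i = 0`; pass to
its support (all `a_i ≠ 0`, at least two indices). Let `ρ, σ` be the near frame (`exists_nearFrame`: `Σ_O ρ_s W_s = 0`,
`f_s(1) g_s(W_j) = δ_sj + ρ_s σ_j`). Ingredients: Brent on `K₀` (`XY = Σ_{s∈O} f_s(X) g_s(Y) W_s`), uniqueness of the output
relation (`rel_cross`: every relation among the `W_s`, `s ∈ O`, is proportional to `ρ`), and the near transport identity
(`near_transport`). (1) A form `g_s` with `ρ_s = 0` transports exactly, so the saturated dichotomy applies to it and, with the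
relation, `g_s(Y_i) = 0` for all `i`. (2) If `X x_i = 0` then `X Y_i = 0`, so the vector `(f_s(X) g_s(Y_i))_s` is a relation,
hence proportional to `ρ`. (3) In fact it vanishes: otherwise all `g_s(Y_i)` (`ρ_s ≠ 0`) are nonzero, the forms `f_s`
restricted to the annihilator of `x_i` are proportional, a common zero `X' ≠ 0` of them in that annihilator kills every `Y_j`,
hence two independent `x`'s, so `X' = 0` — applied to `X' = f_s(X)·A_r − f_s(A_r)·X` (`A_r = e_r ⊗ x_i^⊥`) this forces `X = 0`.
(4) Hence `g_s(Y_i) ≠ 0` forces `f_s` to kill the annihilator of `x_i`; by `not_f_vanish_two_annihilators` the supports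
`P_i = {s : g_s(Y_i) ≠ 0}` are pairwise disjoint. (5) With `X_y^{(i)} = y ⊗ u_i` (`u_i · x_i = 1`):
`Σ_i a_i X_y^{(i)} Y_i = y ⊗ Σ a_i w_i = 0` is a relation whose `s`-coefficient, for `s ∈ P_{i₀}`, is the single product
`a_{i₀} f_s(X_y^{(i₀)}) g_s(Y_{i₀})`; proportionality to `ρ` makes all of them vanish at a nonzero `y₀` in the kernel of the linear
form `y ↦ f_{s₁}(X_y^{(i₀)})`, whence `y₀ ⊗ w_{i₀} = X_{y₀}^{(i₀)} Y_{i₀} = 0` — absurd. Desk control (tensor g36 `test_mcc.py`): on all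
728 near points of the 58 `𝔽₃` schemes `⟨2,2,2⟩@7 … ⟨2,2,5⟩@18` of the cell's collections, `dim(K₀ ∩ k²⊗F) ≤ dim F` for EVERY
subspace `F ≤ 𝔽₃ⁿ` (2 664 subspaces at `n = 5`). Not a rank bound by itself; nothing here is a bound on `ω`.
-/

namespace Summit.MatrixMultiplication.OmegaCensus.SmallFormats

open Module Matrix Literature.Computability.AlgebraicComplexity

namespace NearDeltaLaw

variable {k : Type*} [Field k] {n : ℕ} {ι : Type*} [Fintype ι] [DecidableEq ι]

/-! ## The clause -/

/-- **The multi-column clause at a near point.** See the module docstring. `R = span ρ`, `E ⊇` every `x ⊗ w`, `w ∈ R`,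
`dim E ≤ 2p`; `K₀` killed by the forms `g_t`, `t ∉ O`; `x_0, …, x_p` pairwise independent. Then `dim(K₀ ⊓ E) ≤ p`. -/
theorem near_multi_column_clause (β : BilinComp (mulBilin k 2 2 n) ι) (O : Finset ι)
    (hO : ∀ i, i ∉ O → β.f i 1 = 0) (hO' : ∀ i ∈ O, β.f i 1 ≠ 0) (hcard : O.card = 2 * n + 1)
    {p : ℕ} (ρ : Fin p → (Fin n → k)) (hρ : LinearIndependent k ρ)
    (xs : Fin (p + 1) → (Fin 2 → k)) (hxs : ∀ i j, i ≠ j → xs i 0 * xs j 1 - xs i 1 * xs j 0 ≠ 0)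
    (K₀ : Submodule k (Matrix (Fin 2) (Fin n) k)) (hK₀ : ∀ W ∈ K₀, ∀ t, t ∉ O → β.g t W = 0)
    (E : Submodule k (Matrix (Fin 2) (Fin n) k)) [FiniteDimensional k E]
    (hE : ∀ (x : Fin 2 → k), ∀ w ∈ Submodule.span k (Set.range ρ), vecMulVec x w ∈ E)
    (hEdim : finrank k E ≤ 2 * p) : finrank k ↥(K₀ ⊓ E) ≤ p := by
  classical
  by_contra hlt
  push Not at hlt
  set R := Submodule.span k (Set.range ρ) with hR
  have hRdim : finrank k R = p := by
    rw [hR, finrank_span_eq_card hρ, Fintype.card_fin]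
  rcases Nat.eq_zero_or_pos p with hp | hp
  · subst hp
    have := (Submodule.finrank_mono (inf_le_right : K₀ ⊓ E ≤ E)).trans hEdim
    omega
  haveI : Nontrivial (Fin (p + 1)) := Fin.nontrivial_iff_two_le.mpr (by omega)
  have hx0 : ∀ i, xs i ≠ 0 := by
    intro i h
    obtain ⟨j, hj⟩ := exists_ne i
    exact hxs i j hj.symm (by rw [h]; simp)
  -- (i) each row-plane `x_i ⊗ R` meets `K₀ ⊓ E`
  have hrow : ∀ i, ∃ w ∈ R, w ≠ 0 ∧ vecMulVec (xs i) w ∈ K₀ := by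
    intro i
    set P : Submodule k (Matrix (Fin 2) (Fin n) k) := R.map (DeltaLaw.vecMulVecRight (xs i)) with hP
    have hPdim : finrank k P = p := by
      rw [hP, ← hRdim]
      exact LinearEquiv.finrank_eq
        (Submodule.equivMapOfInjective _ (DeltaLaw.vecMulVecRight_injective (hx0 i)) R).symm
    have hPE : P ≤ E := by
      rintro _ ⟨w, hw, rfl⟩; exact hE _ w hw
    have hKE : K₀ ⊓ E ≤ E := inf_le_right
    have hsum := Submodule.finrank_sup_add_finrank_inf_eq (K₀ ⊓ E) P
    have hsup : finrank k ↥((K₀ ⊓ E) ⊔ P) ≤ 2 * p := (Submodule.finrank_mono (sup_le hKE hPE)).trans hEdim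
    have hpos : 0 < finrank k ↥((K₀ ⊓ E) ⊓ P) := by omega
    have hne : (K₀ ⊓ E) ⊓ P ≠ ⊥ := fun h => by
      rw [h, finrank_bot] at hpos; exact lt_irrefl 0 hpos
    obtain ⟨W, hWmem, hWne⟩ := Submodule.exists_mem_ne_zero_of_ne_bot hne
    obtain ⟨hWKE, hWP⟩ := Submodule.mem_inf.mp hWmem
    obtain ⟨w, hw, hwW⟩ := Submodule.mem_map.mp hWP
    refine ⟨w, hw, fun h0 => hWne ?_, ?_⟩
    · rw [← hwW, h0, map_zero]
    · rw [← DeltaLaw.vecMulVecRight_apply, hwW]; exact (Submodule.mem_inf.mp hWKE).1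
  choose w hwR hwne hwK using hrow
  -- (ii) the `p + 1` vectors `w_i ∈ R` are dependent
  have hdep : ¬ LinearIndependent k w := by
    intro hli
    have h1 : finrank k ↥(Submodule.span k (Set.range w)) = p + 1 := by
      rw [finrank_span_eq_card hli, Fintype.card_fin]
    have h2 : Submodule.span k (Set.range w) ≤ R := Submodule.span_le.mpr (by rintro _ ⟨i, rfl⟩; exact hwR i)
    have := Submodule.finrank_mono h2
    omega
  obtain ⟨a, ha, i₀, hai₀⟩ := Fintype.not_linearIndependent_iff.mp hdep
  -- (iii) the support of the relation has at least two elements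
  have hi₁ : ∃ i, i ≠ i₀ ∧ a i ≠ 0 := by
    by_contra hcon
    push Not at hcon
    have h : a i₀ • w i₀ = 0 := by
      rw [← ha, Finset.sum_eq_single i₀]
      · intro i _ hi; rw [hcon i hi, zero_smul]
      · intro h; exact absurd (Finset.mem_univ _) h
    exact hwne i₀ ((smul_eq_zero.mp h).resolve_left hai₀)
  obtain ⟨i₁, hi₁ne, hai₁⟩ := hi₁
  -- (iv) the core lemma on the support
  have hfilt : ∑ i ∈ Finset.univ.filter (fun i => a i ≠ 0), a i • w i = ∑ i, a i • w i := by
    rw [Finset.sum_filter]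
    refine Finset.sum_congr rfl fun i _ => ?_
    split_ifs with h
    · rfl
    · push Not at h
      rw [h, zero_smul]
  have hrel' : ∑ i : {i : Fin (p + 1) // a i ≠ 0}, a i.1 • w i.1 = 0 := by
    rw [← Finset.sum_subtype (Finset.univ.filter fun i => a i ≠ 0) (by intro x; simp) (fun i => a i • w i),
      hfilt, ha]
  exact near_columns_core β O hO hO' hcard (κ := {i : Fin (p + 1) // a i ≠ 0}) (fun i => xs i.1)
    (fun i j hij => hxs i.1 j.1 (fun h => hij (Subtype.ext h))) (fun i => w i.1) (fun i => hwne i.1)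
    (fun i t ht => hK₀ _ (hwK i.1) t ht) (fun i => a i.1) (fun i => i.2) hrel'
    (i₀ := ⟨i₀, hai₀⟩) (i₁ := ⟨i₁, hai₁⟩) (fun h => hi₁ne (congrArg Subtype.val h).symm)

end NearDeltaLaw

end Summit.MatrixMultiplication.OmegaCensus.SmallFormats
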